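import Literature.Analysis.FluidPDE.AxisymSmallSwirlL4
import Literature.Analysis.FluidPDE.GeneralizedAxisymNS
import HarnessLib

/-!
# Hou 2022: the initial datum of the potentially singular axisymmetric Navier–Stokes computation

T. Y. Hou, *The potentially singular behavior of the 3D Navier–Stokes equations*, Found. Comput.
Math. 23 (2023) 2251–2299 = arXiv:2107.06509, §2 (arXiv pp. 5–7) and §3 (p. 7).

Hou solves the 3-D axisymmetric Navier–Stokes equations with swirl in the Hou–Li variables
`u₁ = u^θ/r`, `ω₁ = ω^θ/r`, `ψ₁ = ψ^θ/r` (the tree's `GeneralizedAxisymNS` at `n = 3`: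
`u₁,t + uʳu₁,r + uᶻu₁,z = 2u₁ψ₁,z + ν(u₁,rr + (3/r)u₁,r) + νu₁,zz`, the `ω₁`-equation, and
`−(∂ᵣ² + (3/r)∂ᵣ + ∂_z²)ψ₁ = ω₁`, `uʳ = −rψ₁,z`, `uᶻ = 2ψ₁ + rψ₁,r`) in the cylinder
`{0 ≤ r ≤ 1}`, periodic in `z` with period `1`, with the pole conditions at `r = 0` and the
no-slip / no-flow conditions `ψ₁ = 0`, `u₁ = 0`, `ω₁ = −ψ₁,rr` at the wall `r = 1` (§2, (2.4)–(2.7)),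
starting from (§2, eq. (2.2), arXiv p. 6):

> "Our smooth initial condition has a very simple form and is given below:
> `u₁(0,r,z) = 12000 (1 − r²)¹⁸ sin(2πz) / (1 + 12.5 (sin(πz))²)`, `ω₁(0,r,z) = 0`.
> The flow is completely driven by large swirl initially. The other two velocity components are
> set to zero initially. Note that `u₁` is an odd and periodic function of `z` with period 1 […]
> `u₁` decays rapidly as `r` approaches the boundary `r = 1`."

and with viscosity `ν = 5·10⁻⁴` up to `t₀ = 0.00227375`, `ν = 5·10⁻³` afterwards (§3, p. 7).

This file TYPES the datum (definitions with bodies) and PROVES its printed structural properties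
— the object every axisymmetric "Hou-datum" run of the profile search starts from:

* `Hou2022.initialU1 r z` — the profile `u₁(0, r, z)` above; `Hou2022.nuEarly`, `Hou2022.nuLate`,
  `Hou2022.tSwitch` — the printed viscosity schedule (data);
* `Hou2022.swirlProfile x = u₁(0, |x'|, x₃)` written polynomially in `x₀² + x₁²`, and the 3-D
  velocity datum `Hou2022.initialVelocity x = swirlProfile x • (−x₁, x₀, 0) = r u₁ e_θ`
  (pure swirl: `uʳ = uᶻ = 0`);
* PROVED: `u₁(0,·)` is odd and `1`-periodic in `z`, even in `r`, vanishes at the wall `r = 1`,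
  `|u₁(0,r,z)| ≤ 12000` for `|r| ≤ 1` (`Hou2022.abs_initialU1_le`), smooth; the velocity datum is
  smooth, axisymmetric (`Hou2022.isAxisymmetric_initialVelocity`), divergence free
  (`Hou2022.isDivFree_initialVelocity`), vanishes at the wall, has NO poloidal part
  (`Hou2022.poloidalPart_initialVelocity`), its swirl is `Γ₀ = r² u₁(0,r,z)`
  (`Hou2022.swirl_initialVelocity`) with `|Γ₀| ≤ 12000` in the pipe `r ≤ 1`
  (`Hou2022.abs_swirl_initialVelocity_le`), and it is the field
  `GeneralizedAxisymNS.toVelocity u₁(0,·) 0` of Hou's system vocabulary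
  (`Hou2022.initialVelocity_eq_toVelocity`).

Nothing about the evolution is asserted (the computation is numerical evidence, §3; the fitted
rates are data in `HouTwoScaleRescaling.lean`'s docstrings and `not_jointFit_sqrtRate_logRate`).

WHAT THIS IS NOT: not a claim about Navier–Stokes blow-up — a printed initial datum as Lean
definitions with its elementary properties proved.

## References

* T. Y. Hou, Found. Comput. Math. 23 (2023) = arXiv:2107.06509: §2 pp. 5–7 (system (2.1),
  datum (2.2), pole conditions (2.3), no-flow/no-slip (2.4)–(2.6), half-period domain 𝒟₁),
  §3 p. 7 (viscosity `5·10⁻⁴` until `t₀ = 0.00227375`, then `5·10⁻³`).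
  [`Hou2022PotentiallySingularNS`]
* T. Y. Hou, R. Li, Comm. Pure Appl. Math. 61 (2008) (the variables `u₁, ω₁, ψ₁`). [`HouLi2007`]
-/

noncomputable section

open Set Function Real InnerProductSpace
open scoped ContDiff RealInnerProductSpace

namespace Literature.Analysis.FluidPDE

namespace Hou2022

/-! ### The printed data -/

/-- **Hou's initial angular velocity profile** `u₁(0, r, z) = 12000 (1 − r²)¹⁸ sin(2πz) /
(1 + 12.5 sin²(πz))` (arXiv:2107.06509, §2 eq. (2.2)); `ω₁(0,·) = 0` and `ψ₁(0,·) = 0` (the other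
two velocity components vanish initially). A function of `(r, z) ∈ ℝ²`; the flow lives on
`0 ≤ r ≤ 1`, `z ∈ ℝ/ℤ`. [cite: Hou2022PotentiallySingularNS, §2 eq. (2.2) (arXiv p. 6)] -/
def initialU1 (r z : ℝ) : ℝ :=
  12000 * (1 - r ^ 2) ^ 18 * Real.sin (2 * π * z) / (1 + 12.5 * Real.sin (π * z) ^ 2)

/-- The early-stage viscosity `ν = 5·10⁻⁴` (used for `0 ≤ t ≤ t₀`).
[cite: Hou2022PotentiallySingularNS, §3 (arXiv p. 7)] -/
def nuEarly : ℝ := 5e-4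

/-- The late-stage viscosity `ν = 5·10⁻³` (used for `t > t₀`).
[cite: Hou2022PotentiallySingularNS, §3 (arXiv p. 7)] -/
def nuLate : ℝ := 5e-3

/-- The switching time `t₀ = 0.00227375` of the viscosity schedule.
[cite: Hou2022PotentiallySingularNS, §3 (arXiv p. 7) and §3.3 (p. 10)] -/
def tSwitch : ℝ := 0.00227375

/-- The viscosity schedule is a genuine jump by a factor `10`: the computation is NOT one
constant-viscosity Navier–Stokes evolution on `[0, T)` (the early and late stages are).
[cite: Hou2022PotentiallySingularNS, §3 (arXiv p. 7)] -/
theorem nuLate_eq_ten_mul_nuEarly : nuLate = 10 * nuEarly := by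
  norm_num [nuLate, nuEarly]

/-- Both viscosities are positive. [cite: Hou2022PotentiallySingularNS, §3 (arXiv p. 7)] -/
theorem nuEarly_pos : 0 < nuEarly := by norm_num [nuEarly]

/-! ### Printed structural properties of `u₁(0, ·)` -/

/-- The denominator `1 + 12.5 sin²(πz)` is at least `1`. [cite: Hou2022PotentiallySingularNS, §2 eq. (2.2)] -/
theorem one_le_denom (z : ℝ) : 1 ≤ 1 + 12.5 * Real.sin (π * z) ^ 2 := by
  nlinarith [sq_nonneg (Real.sin (π * z))]

/-- The denominator is positive. [cite: Hou2022PotentiallySingularNS, §2 eq. (2.2)] -/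
theorem denom_pos (z : ℝ) : 0 < 1 + 12.5 * Real.sin (π * z) ^ 2 :=
  lt_of_lt_of_le one_pos (one_le_denom z)

/-- **`u₁(0,·)` is odd in `z`** ("`u₁` is an odd […] function of `z`", §2 p. 6).
[cite: Hou2022PotentiallySingularNS, §2 (arXiv p. 6)] -/
theorem initialU1_neg_z (r z : ℝ) : initialU1 r (-z) = -initialU1 r z := by
  simp only [initialU1, mul_neg, Real.sin_neg, neg_sq]
  ring

/-- **`u₁(0,·)` is periodic in `z` with period `1`** (§2 p. 6).
[cite: Hou2022PotentiallySingularNS, §2 (arXiv p. 6)] -/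
theorem initialU1_periodic (r : ℝ) : Function.Periodic (initialU1 r) 1 := by
  intro z
  have h1 : Real.sin (2 * π * (z + 1)) = Real.sin (2 * π * z) := by
    rw [mul_add, mul_one, Real.sin_add_two_pi]
  have h2 : Real.sin (π * (z + 1)) ^ 2 = Real.sin (π * z) ^ 2 := by
    rw [mul_add, mul_one, Real.sin_add_pi, neg_sq]
  simp only [initialU1, h1, h2]

/-- **`u₁(0,·)` is even in `r`** ("`u₁, ω₁, ψ₁` is an even function of `r`", §2 p. 6: the pole
conditions (2.3)). [cite: Hou2022PotentiallySingularNS, §2 (2.3) (arXiv p. 6)] -/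
theorem initialU1_neg_r (r z : ℝ) : initialU1 (-r) z = initialU1 r z := by
  simp only [initialU1, neg_sq]

/-- **`u₁(0,·)` vanishes at the wall `r = 1`** (compatible with the no-slip condition
`u₁(t, 1, z) = 0`, §2 (2.6)). [cite: Hou2022PotentiallySingularNS, §2 (2.6) (arXiv p. 6)] -/
theorem initialU1_wall (z : ℝ) : initialU1 1 z = 0 := by
  simp [initialU1]

/-- `u₁(0,·)` vanishes on the planes `z ∈ ½ℤ` bounding the half-period domain `𝒟₁` (`sin(2πz) = 0`
at `z = 0, 1/2`). [cite: Hou2022PotentiallySingularNS, §2 (domain 𝒟₁, arXiv p. 6)] -/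
theorem initialU1_z_zero (r : ℝ) : initialU1 r 0 = 0 := by
  simp [initialU1]

/-- **Size of the datum**: `|u₁(0, r, z)| ≤ 12000` for `|r| ≤ 1` (`0 ≤ 1 − r² ≤ 1`,
`|sin| ≤ 1`, denominator `≥ 1`). [cite: Hou2022PotentiallySingularNS, §2 eq. (2.2) (arXiv p. 6)] -/
theorem abs_initialU1_le {r : ℝ} (hr : |r| ≤ 1) (z : ℝ) : |initialU1 r z| ≤ 12000 := by
  have hr2 : r ^ 2 ≤ 1 := by
    have := abs_le.1 hr
    nlinarith
  have h0 : 0 ≤ 1 - r ^ 2 := by linarith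
  have h1 : (1 - r ^ 2) ^ 18 ≤ 1 := pow_le_one₀ h0 (by linarith [sq_nonneg r])
  have h1' : 0 ≤ (1 - r ^ 2) ^ 18 := pow_nonneg h0 18
  have hs : |Real.sin (2 * π * z)| ≤ 1 := Real.abs_sin_le_one _
  have hd := denom_pos z
  have hd1 := one_le_denom z
  rw [initialU1, abs_div, abs_of_pos hd, div_le_iff₀ hd, abs_mul, abs_mul,
    abs_of_nonneg h1', show |(12000 : ℝ)| = 12000 by norm_num]
  calc 12000 * (1 - r ^ 2) ^ 18 * |Real.sin (2 * π * z)| ≤ 12000 * 1 * 1 := by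
        gcongr
    _ ≤ 12000 * (1 + 12.5 * Real.sin (π * z) ^ 2) := by nlinarith

/-- `u₁(0,·)` is smooth on `ℝ²` (polynomial in `r`, trigonometric in `z`, positive denominator).
[cite: Hou2022PotentiallySingularNS, §2 (arXiv p. 6: "Our smooth initial condition")] -/
theorem contDiff_initialU1 : ContDiff ℝ ∞ fun q : ℝ × ℝ => initialU1 q.1 q.2 := by
  unfold initialU1
  refine ContDiff.div ?_ ?_ fun q => (denom_pos q.2).ne'
  · exact ((contDiff_const.mul ((contDiff_const.sub (contDiff_fst.pow 2)).pow 18)).mul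
      (Real.contDiff_sin.comp (contDiff_const.mul contDiff_snd)))
  · exact contDiff_const.add (contDiff_const.mul
      ((Real.contDiff_sin.comp (contDiff_const.mul contDiff_snd)).pow 2))

/-! ### The 3-D velocity datum -/

/-- The swirl profile of the datum as a scalar field on `ℝ³`: `Φ(x) = u₁(0, |x'|, x₃)`, written
through `|x'|² = x₀² + x₁²` (no square root: `u₁` is even in `r`).
[cite: Hou2022PotentiallySingularNS, §2 eq. (2.2) (arXiv p. 6)] -/
def swirlProfile (x : EuclideanSpace ℝ (Fin 3)) : ℝ :=
  12000 * (1 - (x 0 ^ 2 + x 1 ^ 2)) ^ 18 * Real.sin (2 * π * x 2) /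
    (1 + 12.5 * Real.sin (π * x 2) ^ 2)

/-- `Φ(x) = u₁(0, r(x), x₃)` with `r = cylRadius`. [cite: Hou2022PotentiallySingularNS, §2 eq. (2.2) (arXiv p. 6)] -/
theorem swirlProfile_eq (x : EuclideanSpace ℝ (Fin 3)) :
    swirlProfile x = initialU1 (cylRadius x) (x 2) := by
  rw [swirlProfile, initialU1, cylRadius_sq]

/-- **Hou's velocity datum on `ℝ³`**: `u₀(x) = uᶿ e_θ = r u₁(0,r,z) e_θ = u₁(0,r,z)·(−x₁, x₀, 0)`
(pure swirl: "the flow is completely driven by large swirl initially; the other two velocity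
components are set to zero", §2 p. 6), i.e. `Φ(x) • J x` with the rotation generator
`J x = (−x₁, x₀, 0)` (`rotGenL`). The physical flow is its restriction to the pipe `r ≤ 1`.
[cite: Hou2022PotentiallySingularNS, §2 eq. (2.2) and the sentence after it (arXiv p. 6)] -/
def initialVelocity (x : EuclideanSpace ℝ (Fin 3)) : EuclideanSpace ℝ (Fin 3) :=
  swirlProfile x • rotGenL x

/-- The swirl profile is an axisymmetric scalar (it depends on `x₀² + x₁²` and `x₃` only).
[cite: Hou2022PotentiallySingularNS, §2 (arXiv pp. 5–6: axisymmetric flow)] -/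
theorem isAxisymmetricScalar_swirlProfile : IsAxisymmetricScalar swirlProfile := by
  intro θ x
  rw [swirlProfile_eq, swirlProfile_eq, cylRadius_rotZ, rotZ_apply_two]

/-- **The datum is axisymmetric.** [cite: Hou2022PotentiallySingularNS, §2 (arXiv pp. 5–6)] -/
theorem isAxisymmetric_initialVelocity : IsAxisymmetric initialVelocity :=
  isAxisymmetric_smul_rotGenL isAxisymmetricScalar_swirlProfile

/-- The swirl profile is smooth on `ℝ³`. [cite: Hou2022PotentiallySingularNS, §2 (arXiv p. 6)] -/
theorem contDiff_swirlProfile : ContDiff ℝ ∞ swirlProfile := by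
  have h0 : ContDiff ℝ ∞ fun x : EuclideanSpace ℝ (Fin 3) => x 0 :=
    contDiff_piLp_apply (𝕜 := ℝ) (p := 2) (i := (0 : Fin 3))
  have h1 : ContDiff ℝ ∞ fun x : EuclideanSpace ℝ (Fin 3) => x 1 :=
    contDiff_piLp_apply (𝕜 := ℝ) (p := 2) (i := (1 : Fin 3))
  have h2 : ContDiff ℝ ∞ fun x : EuclideanSpace ℝ (Fin 3) => x 2 :=
    contDiff_piLp_apply (𝕜 := ℝ) (p := 2) (i := (2 : Fin 3))
  unfold swirlProfile
  refine ContDiff.div ?_ ?_ fun x => (denom_pos (x 2)).ne'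
  · exact (contDiff_const.mul ((contDiff_const.sub ((h0.pow 2).add (h1.pow 2))).pow 18)).mul
      (Real.contDiff_sin.comp (contDiff_const.mul h2))
  · exact contDiff_const.add (contDiff_const.mul
      ((Real.contDiff_sin.comp (contDiff_const.mul h2)).pow 2))

/-- **The datum is smooth** (`Φ` smooth, `J` linear). [cite: Hou2022PotentiallySingularNS, §2 (arXiv p. 6)] -/
theorem contDiff_initialVelocity : ContDiff ℝ ∞ initialVelocity :=
  contDiff_swirlProfile.smul rotGenL.contDiff

/-- **The datum is divergence free** (a swirl field `Φ(r,z)·(−x₁, x₀, 0)` with axisymmetric `Φ`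
is solenoidal). [cite: Hou2022PotentiallySingularNS, §2 (arXiv pp. 5–6)] -/
theorem isDivFree_initialVelocity : VectorCalculus.IsDivFree initialVelocity := fun x =>
  divergence_smul_rotGenL isAxisymmetricScalar_swirlProfile
    (contDiff_swirlProfile.differentiable (by simp)).differentiableAt

/-- **The swirl of the datum**: `Γ₀(x) = r uᶿ = r² u₁(0, r, z) = (x₀² + x₁²) Φ(x)`.
[cite: Hou2022PotentiallySingularNS, §2 (arXiv p. 5: u₁ = uᶿ/r) with eq. (2.2)] -/
theorem swirl_initialVelocity (x : EuclideanSpace ℝ (Fin 3)) :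
    swirl initialVelocity x = (x 0 ^ 2 + x 1 ^ 2) * swirlProfile x := by
  simp only [swirl, initialVelocity, PiLp.smul_apply, smul_eq_mul, rotGenL_apply,
    rotGen_apply_zero, rotGen_apply_one]
  ring

/-- The swirl of the datum in cylindrical terms: `Γ₀ = r² u₁(0, r, z)`.
[cite: Hou2022PotentiallySingularNS, §2 (arXiv pp. 5–6)] -/
theorem swirl_initialVelocity_eq (x : EuclideanSpace ℝ (Fin 3)) :
    swirl initialVelocity x = cylRadius x ^ 2 * initialU1 (cylRadius x) (x 2) := by
  rw [swirl_initialVelocity, ← cylRadius_sq, swirlProfile_eq]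

/-- **Bounded initial circulation in the pipe**: `|Γ₀(x)| ≤ 12000` for `r(x) ≤ 1` (`r² ≤ 1` and
`|u₁(0)| ≤ 12000`). This is the hypothesis `‖Γ₀‖_∞ < ∞` of the circulation maximum principle and
of the `C/r`-on-the-poloidal-part criteria (`KNSSPoloidalAxisDecay.lean`) for this datum.
[cite: Hou2022PotentiallySingularNS, §2 eq. (2.2) (arXiv p. 6)] -/
theorem abs_swirl_initialVelocity_le {x : EuclideanSpace ℝ (Fin 3)} (hx : cylRadius x ≤ 1) :
    |swirl initialVelocity x| ≤ 12000 := by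
  have hr0 := cylRadius_nonneg x
  have hu := abs_initialU1_le (r := cylRadius x) (by rwa [abs_of_nonneg hr0]) (x 2)
  have hr2 : cylRadius x ^ 2 ≤ 1 := pow_le_one₀ hr0 hx
  rw [swirl_initialVelocity_eq, abs_mul, abs_of_nonneg (sq_nonneg _)]
  calc cylRadius x ^ 2 * |initialU1 (cylRadius x) (x 2)| ≤ 1 * 12000 :=
        mul_le_mul hr2 hu (abs_nonneg _) zero_le_one
    _ = 12000 := one_mul _

/-- **The datum satisfies the no-slip condition at the wall**: `u₀(x) = 0` for `r(x) = 1`.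
[cite: Hou2022PotentiallySingularNS, §2 (2.6) (arXiv p. 6)] -/
theorem initialVelocity_wall {x : EuclideanSpace ℝ (Fin 3)} (hx : cylRadius x = 1) :
    initialVelocity x = 0 := by
  have h : swirlProfile x = 0 := by rw [swirlProfile_eq, hx, initialU1_wall]
  simp [initialVelocity, h]

/-- **The datum has no poloidal part**: `ū₀ = u₀ − u₀ᶿ e_θ = 0` ("the other two velocity
components are set to zero initially", §2 p. 6) — the weighted poloidal velocity `r|ū|` of the
`C/r` criteria starts from `0`. [cite: Hou2022PotentiallySingularNS, §2 (arXiv p. 6)] -/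
theorem poloidalPart_initialVelocity (x : EuclideanSpace ℝ (Fin 3)) :
    poloidalPart initialVelocity x = 0 := by
  rw [poloidalPart_eq_sub_smul_rotGen, swirl_initialVelocity, ← cylRadius_sq]
  by_cases hx : cylRadius x = 0
  · obtain ⟨h0, h1⟩ := (cylRadius_eq_zero_iff x).1 hx
    ext i
    fin_cases i <;> simp [initialVelocity, rotGenL_apply, rotGen, h0, h1]
  · have hr : cylRadius x ^ 2 ≠ 0 := pow_ne_zero 2 hx
    rw [mul_div_cancel_left₀ _ hr, initialVelocity, rotGenL_apply, sub_self]

/-- **Dictionary with Hou's system vocabulary**: the datum is the `n = 3` velocity field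
`GeneralizedAxisymNS.toVelocity u₁(0,·) ψ₁(0,·)` of the Hou–Li variables with `ψ₁(0,·) = 0`
(`uʳ = −rψ₁,z = 0`, `uᶻ = 2ψ₁ + rψ₁,r = 0`, `uᶿ = r u₁`).
[cite: Hou2022PotentiallySingularNS, §2 (2.1)–(2.2) (arXiv pp. 5–6)] -/
theorem initialVelocity_eq_toVelocity (x : EuclideanSpace ℝ (Fin 3)) :
    initialVelocity x =
      GeneralizedAxisymNS.toVelocity (fun q : ℝ × ℝ => initialU1 q.1 q.2) 0 x := by
  have hz : GeneralizedAxisymNS.radialVel (0 : ℝ × ℝ → ℝ) (meridian x) = 0 := by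
    simp [GeneralizedAxisymNS.radialVel, derivZ]
  have ha : GeneralizedAxisymNS.axialVel 3 (0 : ℝ × ℝ → ℝ) (meridian x) = 0 := by
    simp [GeneralizedAxisymNS.axialVel, derivR]
  rw [GeneralizedAxisymNS.toVelocity, hz, ha, zero_smul, zero_smul, zero_add, add_zero]
  simp only [GeneralizedAxisymNS.swirlVel, meridian_apply]
  rw [← swirlProfile_eq, initialVelocity]
  by_cases hx : cylRadius x = 0
  · obtain ⟨h0, h1⟩ := (cylRadius_eq_zero_iff x).1 hx
    ext i
    fin_cases i <;> simp [rotGenL_apply, rotGen, eTheta, h0, h1, hx]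
  · ext i
    fin_cases i <;> simp [rotGenL_apply, rotGen, eTheta] <;> field_simp

end Hou2022

end Literature.Analysis.FluidPDE

end
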